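import Summits.BirchSwinnertonDyer.BirchSwinnertonDyer.Theorems.KatoDescentTamePotSupersingularCartanMuRoadRealDoorsTprime
import Literature.NumberTheory.EllipticCurves.FineSelmerMuRoadNonsplitCartanFive
import Literature.NumberTheory.EllipticCurves.FineSelmerMuRoadZywinaG9Five
import Literature.NumberTheory.EllipticCurves.FineSelmerMuRoadSplitCartanFive
import Literature.NumberTheory.EllipticCurves.FineSelmerMuRoadSplitCartanFiveIndexTwo
import Literature.NumberTheory.EllipticCurves.FineSelmerMuRoadDoors
import Literature.NumberTheory.IwasawaTheory.ClassicalMuInvariantOnePrimeProofs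
import HarnessLib

/-!
# KT `TameCoatesSujathaResidue` (stmt-19916; U₀-ns node 19202 → parent 19982) — the `p = 5` Cartan / `G₉` μ-road DOORS for the
# (t′) rows with mod-5 image `N_ns(5)` (`5Nn`) or Zywina's `G₉` (`5S4`): the U₀ statement `MissingUpperBoundAt W 5` on a rank-`0`
# (t′) row with `W[5]` irreducible, from statement (A) at `(W, 5)` produced by conjA-anchor g12's fact-free descent chains
# (cell `bsd-potss`, seat `bsd-potss-k8t-c4` g17; `p = 5` twin of g16's `CartanMuRoadRealDoorsTprime` §2; route-free;
# `--supports stmt-BirchSwinnertonDyer-19982 --as helper`; closes nothing)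

HONEST FRAMING. Route-free THEOREMS ONLY (no definition, no named fact, no `sorry`). conjA-anchor g12's Literature theorems
`CoatesSujatha2005.fineSelmerDual_moduleFinite_of_nonsplitCartanBasis_five` (R5′, p631760: image `C_ns⁺(ε)`, seven `μ`-inputs on
subfields of `ℚ(W[5])` of degree `24, 12, 12, 6, 6, 6, 3`), `…_of_hasModPImageEqNonsplitCartanNormalizer_five` (the same from the tree
predicate `HasModPImageEqNonsplitCartanNormalizer W 5`, `μ`-input quantified over all bases) and
`CoatesSujatha2005.fineSelmerDual_moduleFinite_of_zywinaG9Basis_five` (R5″, p633656: image `G₉ = 5S4`, six `μ`-inputs on subfields of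
degree `24, 24, 24, 24, 12, 12`) give statement (A) at `(W, 5)` — `Y(W/ℚ^cyc)` finitely generated over `ℤ_5` for every cyclotomic
`ℤ_5`-extension — modulo the ONE named fact Coates–Sujatha 2005 Thm. 3.4 (`hCS`; no growth theorem, no Ferrero–Washington: the chains are
Kuroda equalities). THIS FILE composes them with the fine-Selmer port of Kato 14.5 (3) on an irreducible rank-`0` (t′) row (§1, a private
verbatim re-homing of `Theorems.missingUpperBoundAt_tame_of_irreducible_of_fineSelmerDual_fg`, whose module imports the route; g16's
`CartanMuRoadRealDoorsTprime` holds the same private copy for `p = 3`): §2 are the three KT doors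
`MissingUpperBoundAt W 5 ⟸ {hKatoA, hGZK, hmod, hCS} + r_an = 0 + Addv W 5 + SubTprime W 5 + W[5] irreducible + image basis data + μ-inputs`.
On the KT census these doors serve the 55 `CHAIN:PASS` rows of conjA-anchor g12's unit norm-index census (ROW-STATUS-conjA-anchor-g12.tsv;
31 `5Nn` + 24 `5S4`, all U₀-ns rank-`0` rows) as a SECOND per-row road beside the unit-twist records, and give the `ellrank`-exhausted ♯ row
100575q1 its first U₀ record. Nothing is asserted about any curve; (A), Conjecture A and BSD are proved for no curve here.
[cite: CoatesSujatha2005, Thm. 3.4 (§3)] [cite: Kato2004Asterisque, Thm. 14.5 (3) (p. 236), Thm. 12.5 (3) (p. 222), 14.14 (p. 243)]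
[cite: Serre1972, §2.2] [cite: Zywina2015, §1.3] [cite: Lemmermeyer1994, §1] [cite: Washington1997, §13.1] [cite: Miller2011LMS, Def. 1.1]
-/

set_option linter.dupNamespace false
set_option autoImplicit false

noncomputable section

open scoped Classical NumberField Matrix
open Field IntermediateField WeierstrassCurve Literature.NumberTheory.EllipticCurves
  Literature.NumberTheory.EllipticCurves.Rank1Residual
  Literature.NumberTheory.EllipticCurves.Rank1Residual.Typed
  Literature.NumberTheory.GaloisRepresentations Literature.NumberTheory.SerreUniformity
  Literature.NumberTheory.EllipticCurves.Zywina2015G9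
  Literature.NumberTheory.IwasawaTheory
  Summit.BirchSwinnertonDyer.Rank1Residual Summit.BirchSwinnertonDyer.Rank1Residual.Additive

namespace Summit.BirchSwinnertonDyer.BirchSwinnertonDyer.Theorems.CartanMuRoadDoorsTprimeFive

/-! ### §1 The fine-Selmer port of Kato 14.5 (3) on an irreducible rank-`0` (t′) row (private re-homing) -/

/-- **The fine-Selmer port of Kato 14.5 (3) on an irreducible rank-`0` (t′) row** (private verbatim re-homing of
`Theorems.missingUpperBoundAt_tame_of_irreducible_of_fineSelmerDual_fg`, whose module imports the route): at an odd additive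
potentially good `p` with `E[p]` irreducible and `Y(E/ℚ^cyc)` finitely generated over `ℤ_p` (`hA`), the upper half
(`ord_p #Ш + v_p ∏c_ℓ ≤ ord_p (L/Ω)`, `#Ш_an = (L/Ω)·#tors²/∏c_ℓ`, torsion term killed by irreducibility).
[cite: Kato2004Asterisque, Thm. 14.5 (3) (p. 236), Thm. 12.5 (3) (p. 222), 14.14 (p. 243)] [cite: Lim2017FineSelmer, §3]
[cite: Miller2011LMS, Def. 1.1] -/
private theorem missingUpperBoundAt_tame_of_irreducible_of_fineSelmerDual_fg
    (hKatoA :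
      Kato2004.rankZero_padicValNat_sha_add_padicValNat_tamagawa_le_of_additive_potGood_of_irreducible_of_fineSelmerDual_fg)
    (hGZK : rank_eq_analyticRank_of_analyticRank_le_one) (hmod : hasEntireLFunction_rat)
    (W : WeierstrassCurve ℚ) [W.IsElliptic] [W.IsGloballyMinimal] (p : ℕ) [Fact p.Prime]
    (hr : W.analyticRank = 0) (hp2 : p ≠ 2) (hadd : Addv W p) (hT : SubTprime W p)
    (hirr : W.HasIrreducibleModPGaloisRep p)
    (hA : ∀ (κ : ZpExtension ℚ p), κ.IsCyclotomic →
      ∃ (γ : Field.absoluteGaloisGroup ℚ) (D : W.FineSelmerDualData κ γ),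
        Module.Finite ℤ_[p] (RestrictScalars ℤ_[p] (IwasawaAlgebra p) D.X)) :
    MissingUpperBoundAt W p := by
  have hO5 : ClassO5 W p := ⟨hp2, hadd, Or.inr hT⟩
  have hL : W.entireLFunction 1 ≠ 0 := (W.analyticRank_eq_zero_iff_holds (hmod W)).mp hr
  obtain ⟨hmw, hfin⟩ := hGZK W (by rw [hr]; exact zero_le_one)
  haveI : Finite W.sha := hfin
  have hmw0 : W.mordellWeilRank = 0 := by rw [hmw, hr]
  obtain ⟨q₀, hq₀, hle⟩ := hKatoA W p hp2 hadd.1 hadd.2 hO5.padicValRat_j_nonneg hirr hA hL hfin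
  have hΩpos : 0 < W.realPeriodRat := W.realPeriodRat_pos_holds
  have hΩ : (W.realPeriodRat : ℂ) ≠ 0 := by exact_mod_cast hΩpos.ne'
  have hc0 : 0 < W.tamagawaProduct := W.tamagawaProduct_pos_holds
  have ht0 : 0 < W.torsionOrder := W.torsionOrder_pos_holds
  have hq₀0 : q₀ ≠ 0 := by
    rintro rfl
    rw [Rat.cast_zero, div_eq_zero_iff] at hq₀
    exact hq₀.elim hL hΩ
  refine ⟨q₀ * (W.torsionOrder : ℚ) ^ 2 / (W.tamagawaProduct : ℚ), ?_, ?_⟩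
  · have hLq : W.entireLFunction 1 = (q₀ : ℂ) * (W.realPeriodRat : ℂ) := by
      rw [← hq₀, div_mul_cancel₀ _ hΩ]
    rw [shaAn_def, W.leadingLCoeff_eq_of_analyticRank_eq_zero hr,
      W.regulator_eq_one_of_rank_zero hmw0, hLq]
    push_cast
    field_simp
  · have ht : (W.torsionOrder : ℚ) ≠ 0 := by exact_mod_cast ht0.ne'
    have hcq : (W.tamagawaProduct : ℚ) ≠ 0 := by exact_mod_cast hc0.ne'
    have hsha : padicValNat p (Nat.card (AddCommGroup.primaryComponent W.sha p)) =
        padicValNat p W.shaOrder := by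
      unfold WeierstrassCurve.shaOrder
      exact padicValNat_card_addPrimaryComponent p
    have htors : (padicValNat p W.torsionOrder : ℤ) = 0 := by
      exact_mod_cast padicValNat_torsionOrder_eq_zero_of_irreducible W p hirr
    have hv : padicValRat p (q₀ * (W.torsionOrder : ℚ) ^ 2 / (W.tamagawaProduct : ℚ)) =
        padicValRat p q₀ + 2 * (padicValNat p W.torsionOrder : ℤ) -
          (padicValNat p W.tamagawaProduct : ℤ) := by
      rw [padicValRat.div (mul_ne_zero hq₀0 (pow_ne_zero 2 ht)) hcq,
        padicValRat.mul hq₀0 (pow_ne_zero 2 ht), pow_two, padicValRat.mul ht ht,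
        padicValRat.of_nat, padicValRat.of_nat]
      ring
    rw [hv, ← hsha, htors]
    linarith


/-! ### §2 The KT doors at `p = 5`: U₀ `MissingUpperBoundAt W 5` at a (t′) `5Nn` / `5S4` row through (A) -/

section Upper

variable (W : WeierstrassCurve ℚ) [W.IsElliptic] [W.IsGloballyMinimal]

/-- **U₀ at a `5Nn` (t′) row from seven classical `μ`-hypotheses** (BASIS form, R5′): `ord₅ #Ш(W) ≤ ord₅ #Ш_an(W)`
(`MissingUpperBoundAt W 5`) for a rank-`0` (t′) row (`Addv W 5`, `SubTprime W 5`) with `W[5]` irreducible, from Kato's fine-Selmer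
reading (`hKatoA`), GZK (`hGZK`), modularity (`hmod`), Coates–Sujatha Thm. 3.4 (`hCS`) — named facts — a basis `e` of `W[5]` in which
`Γ_ℚ` acts through `C_ns⁺(ε)` (`hε`, `he`), elements `σ_x, σ_s` acting as `R_ε = (1 ε(4−ε); 4−ε 1)` and `diag(1, −1)` (`hσx`, `hσs`),
and `μ = 0` for the cyclotomic `ℤ_5`-extensions of the seven fixed fields `ℚ(W[5])^H`, `H = ⟨σ̄_s⟩, ⟨σ̄_x¹², σ̄_s⟩, ⟨σ̄_x⁶σ̄_s⟩, ⟨σ̄_x³⟩,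
⟨σ̄_x⁶, σ̄_s⟩, ⟨σ̄_x⁶, σ̄_x³σ̄_s⟩, ⟨σ̄_x³, σ̄_s⟩` (degrees `24, 12, 12, 6, 6, 6, 3`). CONDITIONAL; nothing booked; BSD for no curve.
[cite: Kato2004Asterisque, Thm. 14.5 (3) (p. 236), Thm. 12.5 (3) (p. 222)] [cite: CoatesSujatha2005, Thm. 3.4 (§3)]
[cite: Serre1972, §2.2] [cite: Lemmermeyer1994, §1] -/
theorem missingUpperBoundAt_five_tame_of_nonsplitCartanBasis_of_mu
    (hKatoA : Kato2004.rankZero_padicValNat_sha_add_padicValNat_tamagawa_le_of_additive_potGood_of_irreducible_of_fineSelmerDual_fg)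
    (hGZK : rank_eq_analyticRank_of_analyticRank_le_one) (hmod : hasEntireLFunction_rat)
    (hCS : CoatesSujatha2005.thm34_fineSelmerDual_moduleFinite_of_classicalMuVanishes_divisionField) [Fact (5 : ℕ).Prime]
    (hr : W.analyticRank = 0) (hadd : Addv W 5) (hT : SubTprime W 5) (hirr : W.HasIrreducibleModPGaloisRep 5)
    (e : W.geomTorsion (5 : ℕ) ≃+ (Fin 2 → ZMod 5)) {ε : ZMod 5} (hε : ¬ IsSquare ε)
    (he : ∀ σ : absoluteGaloisGroup ℚ, ∃ M ∈ nonsplitCartanNormalizer ε, ∀ P : W.geomTorsion (5 : ℕ), e (σ • P) = M *ᵥ e P)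
    (σx σs : absoluteGaloisGroup ℚ) (hσx : ∀ P : W.geomTorsion (5 : ℕ), e (σx • P) = !![1, ε * (4 - ε); 4 - ε, 1] *ᵥ e P)
    (hσs : ∀ P : W.geomTorsion (5 : ℕ), e (σs • P) = !![1, 0; 0, 4] *ᵥ e P)
    (hμP : ∀ κE : ZpExtension ↥(fixedField (Subgroup.zpowers (absRestrictNormalHom (W.divisionField 5) σs))) 5,
      κE.IsCyclotomic → ClassicalMuVanishes κE)
    (hμB₁ : ∀ κE : ZpExtension ↥(fixedField (Subgroup.zpowers (absRestrictNormalHom (W.divisionField 5) σx ^ 12) ⊔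
        Subgroup.zpowers (absRestrictNormalHom (W.divisionField 5) σs))) 5,
      κE.IsCyclotomic → ClassicalMuVanishes κE)
    (hμB₁' : ∀ κE : ZpExtension ↥(fixedField (Subgroup.zpowers (absRestrictNormalHom (W.divisionField 5) σx ^ 6 *
        absRestrictNormalHom (W.divisionField 5) σs))) 5,
      κE.IsCyclotomic → ClassicalMuVanishes κE)
    (hμS : ∀ κE : ZpExtension ↥(fixedField (Subgroup.zpowers (absRestrictNormalHom (W.divisionField 5) σx ^ 3))) 5,
      κE.IsCyclotomic → ClassicalMuVanishes κE)
    (hμB₂ : ∀ κE : ZpExtension ↥(fixedField (Subgroup.zpowers (absRestrictNormalHom (W.divisionField 5) σx ^ 6) ⊔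
        Subgroup.zpowers (absRestrictNormalHom (W.divisionField 5) σs))) 5,
      κE.IsCyclotomic → ClassicalMuVanishes κE)
    (hμB₂' : ∀ κE : ZpExtension ↥(fixedField (Subgroup.zpowers (absRestrictNormalHom (W.divisionField 5) σx ^ 6) ⊔
        Subgroup.zpowers (absRestrictNormalHom (W.divisionField 5) σx ^ 3 * absRestrictNormalHom (W.divisionField 5) σs))) 5,
      κE.IsCyclotomic → ClassicalMuVanishes κE)
    (hμB₃ : ∀ κE : ZpExtension ↥(fixedField (Subgroup.zpowers (absRestrictNormalHom (W.divisionField 5) σx ^ 3) ⊔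
        Subgroup.zpowers (absRestrictNormalHom (W.divisionField 5) σs))) 5,
      κE.IsCyclotomic → ClassicalMuVanishes κE) :
    MissingUpperBoundAt W 5 :=
  missingUpperBoundAt_tame_of_irreducible_of_fineSelmerDual_fg hKatoA hGZK hmod W 5 hr (by decide) hadd hT hirr
    (CoatesSujatha2005.fineSelmerDual_moduleFinite_of_nonsplitCartanBasis_five hCS W e hε he σx σs hσx hσs
      hμP hμB₁ hμB₁' hμS hμB₂ hμB₂' hμB₃)

/-- **U₀ at a `5Nn` (t′) row from the tree predicate `HasModPImageEqNonsplitCartanNormalizer W 5`** (PREDICATE form): as above, with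
the image EQUALITY `himg` displayed and the seven `μ`-inputs quantified over every basis `e`, non-square `ε` and `σ_x, σ_s` acting as
`R_ε`, `diag(1, −1)` (consumer shape of `CoatesSujatha2005.fineSelmerDual_moduleFinite_of_hasModPImageEqNonsplitCartanNormalizer_five`).
CONDITIONAL; nothing booked; BSD for no curve. [cite: Kato2004Asterisque, Thm. 14.5 (3) (p. 236)] [cite: CoatesSujatha2005, Thm. 3.4 (§3)]
[cite: FurioLombardo2023, Thm. 1.5] -/
theorem missingUpperBoundAt_five_tame_of_hasModPImageEqNonsplitCartanNormalizer_of_mu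
    (hKatoA : Kato2004.rankZero_padicValNat_sha_add_padicValNat_tamagawa_le_of_additive_potGood_of_irreducible_of_fineSelmerDual_fg)
    (hGZK : rank_eq_analyticRank_of_analyticRank_le_one) (hmod : hasEntireLFunction_rat)
    (hCS : CoatesSujatha2005.thm34_fineSelmerDual_moduleFinite_of_classicalMuVanishes_divisionField) [Fact (5 : ℕ).Prime]
    (hr : W.analyticRank = 0) (hadd : Addv W 5) (hT : SubTprime W 5) (hirr : W.HasIrreducibleModPGaloisRep 5)
    (himg : HasModPImageEqNonsplitCartanNormalizer W 5)
    (hμ : ∀ (e : W.geomTorsion (5 : ℕ) ≃+ (Fin 2 → ZMod 5)) (ε : ZMod 5), ¬ IsSquare ε →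
      (∀ σ : absoluteGaloisGroup ℚ, ∃ M ∈ nonsplitCartanNormalizer ε, ∀ P : W.geomTorsion (5 : ℕ), e (σ • P) = M *ᵥ e P) →
      ∀ σx σs : absoluteGaloisGroup ℚ, (∀ P : W.geomTorsion (5 : ℕ), e (σx • P) = !![1, ε * (4 - ε); 4 - ε, 1] *ᵥ e P) →
        (∀ P : W.geomTorsion (5 : ℕ), e (σs • P) = !![1, 0; 0, 4] *ᵥ e P) →
      (∀ κE : ZpExtension ↥(fixedField (Subgroup.zpowers (absRestrictNormalHom (W.divisionField 5) σs))) 5,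
        κE.IsCyclotomic → ClassicalMuVanishes κE) ∧
      (∀ κE : ZpExtension ↥(fixedField (Subgroup.zpowers (absRestrictNormalHom (W.divisionField 5) σx ^ 12) ⊔
          Subgroup.zpowers (absRestrictNormalHom (W.divisionField 5) σs))) 5,
        κE.IsCyclotomic → ClassicalMuVanishes κE) ∧
      (∀ κE : ZpExtension ↥(fixedField (Subgroup.zpowers (absRestrictNormalHom (W.divisionField 5) σx ^ 6 *
          absRestrictNormalHom (W.divisionField 5) σs))) 5,
        κE.IsCyclotomic → ClassicalMuVanishes κE) ∧
      (∀ κE : ZpExtension ↥(fixedField (Subgroup.zpowers (absRestrictNormalHom (W.divisionField 5) σx ^ 3))) 5,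
        κE.IsCyclotomic → ClassicalMuVanishes κE) ∧
      (∀ κE : ZpExtension ↥(fixedField (Subgroup.zpowers (absRestrictNormalHom (W.divisionField 5) σx ^ 6) ⊔
          Subgroup.zpowers (absRestrictNormalHom (W.divisionField 5) σs))) 5,
        κE.IsCyclotomic → ClassicalMuVanishes κE) ∧
      (∀ κE : ZpExtension ↥(fixedField (Subgroup.zpowers (absRestrictNormalHom (W.divisionField 5) σx ^ 6) ⊔
          Subgroup.zpowers (absRestrictNormalHom (W.divisionField 5) σx ^ 3 * absRestrictNormalHom (W.divisionField 5) σs))) 5,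
        κE.IsCyclotomic → ClassicalMuVanishes κE) ∧
      (∀ κE : ZpExtension ↥(fixedField (Subgroup.zpowers (absRestrictNormalHom (W.divisionField 5) σx ^ 3) ⊔
          Subgroup.zpowers (absRestrictNormalHom (W.divisionField 5) σs))) 5,
        κE.IsCyclotomic → ClassicalMuVanishes κE)) :
    MissingUpperBoundAt W 5 :=
  missingUpperBoundAt_tame_of_irreducible_of_fineSelmerDual_fg hKatoA hGZK hmod W 5 hr (by decide) hadd hT hirr
    (CoatesSujatha2005.fineSelmerDual_moduleFinite_of_hasModPImageEqNonsplitCartanNormalizer_five hCS W himg hμ)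

/-- **U₀ at a `5S4` (t′) row from six classical `μ`-hypotheses** (BASIS form, R5″): `MissingUpperBoundAt W 5` for a rank-`0` (t′) row
with `W[5]` irreducible, from `hKatoA`, `hGZK`, `hmod`, `hCS` — named facts — a basis `e` of `W[5]` in which `Γ_ℚ` acts through Zywina's
`G₉` (`he`), elements `σ_u, σ_w, σ_t` acting as `diag(1,2)`, `(0 −1; 1 0)`, `(1 1; 1 −1)` (`hσu hσw hσt`), and `μ = 0` for the cyclotomic
`ℤ_5`-extensions of the six fixed fields `ℚ(W[5])^H`, `H = ⟨σ̄_u⟩, ⟨σ̄_w², σ̄_u²⟩, ⟨σ̄_uσ̄_w²⟩, ⟨σ̄_w⟩, ⟨σ̄_u, σ̄_w²⟩, ⟨σ̄_w, σ̄_u²⟩`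
(degrees `24, 24, 24, 24, 12, 12`). CONDITIONAL; nothing booked; BSD for no curve.
[cite: Kato2004Asterisque, Thm. 14.5 (3) (p. 236), Thm. 12.5 (3) (p. 222)] [cite: CoatesSujatha2005, Thm. 3.4 (§3)]
[cite: Zywina2015, §1.3] [cite: Lemmermeyer1994, §1] -/
theorem missingUpperBoundAt_five_tame_of_zywinaG9Basis_of_mu
    (hKatoA : Kato2004.rankZero_padicValNat_sha_add_padicValNat_tamagawa_le_of_additive_potGood_of_irreducible_of_fineSelmerDual_fg)
    (hGZK : rank_eq_analyticRank_of_analyticRank_le_one) (hmod : hasEntireLFunction_rat)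
    (hCS : CoatesSujatha2005.thm34_fineSelmerDual_moduleFinite_of_classicalMuVanishes_divisionField) [Fact (5 : ℕ).Prime]
    (hr : W.analyticRank = 0) (hadd : Addv W 5) (hT : SubTprime W 5) (hirr : W.HasIrreducibleModPGaloisRep 5)
    (e : W.geomTorsion (5 : ℕ) ≃+ (Fin 2 → ZMod 5))
    (he : ∀ σ : absoluteGaloisGroup ℚ, ∃ M ∈ G9, ∀ P : W.geomTorsion (5 : ℕ),
      e (σ • P) = ((M : GL (Fin 2) (ZMod 5)) : Matrix (Fin 2) (Fin 2) (ZMod 5)) *ᵥ e P)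
    (σu σw σt : absoluteGaloisGroup ℚ) (hσu : ∀ P : W.geomTorsion (5 : ℕ), e (σu • P) = !![1, 0; 0, 2] *ᵥ e P)
    (hσw : ∀ P : W.geomTorsion (5 : ℕ), e (σw • P) = !![0, 4; 1, 0] *ᵥ e P)
    (hσt : ∀ P : W.geomTorsion (5 : ℕ), e (σt • P) = !![1, 1; 1, 4] *ᵥ e P)
    (hμP : ∀ κE : ZpExtension ↥(fixedField (Subgroup.zpowers (absRestrictNormalHom (W.divisionField 5) σu))) 5,
      κE.IsCyclotomic → ClassicalMuVanishes κE)
    (hμA₁ : ∀ κE : ZpExtension ↥(fixedField (Subgroup.zpowers (absRestrictNormalHom (W.divisionField 5) σw ^ 2) ⊔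
        Subgroup.zpowers (absRestrictNormalHom (W.divisionField 5) σu ^ 2))) 5,
      κE.IsCyclotomic → ClassicalMuVanishes κE)
    (hμA₂ : ∀ κE : ZpExtension ↥(fixedField (Subgroup.zpowers (absRestrictNormalHom (W.divisionField 5) σu *
        absRestrictNormalHom (W.divisionField 5) σw ^ 2))) 5,
      κE.IsCyclotomic → ClassicalMuVanishes κE)
    (hμA₃ : ∀ κE : ZpExtension ↥(fixedField (Subgroup.zpowers (absRestrictNormalHom (W.divisionField 5) σw))) 5,
      κE.IsCyclotomic → ClassicalMuVanishes κE)
    (hμB₁ : ∀ κE : ZpExtension ↥(fixedField (Subgroup.zpowers (absRestrictNormalHom (W.divisionField 5) σu) ⊔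
        Subgroup.zpowers (absRestrictNormalHom (W.divisionField 5) σw ^ 2))) 5,
      κE.IsCyclotomic → ClassicalMuVanishes κE)
    (hμD : ∀ κE : ZpExtension ↥(fixedField (Subgroup.zpowers (absRestrictNormalHom (W.divisionField 5) σw) ⊔
        Subgroup.zpowers (absRestrictNormalHom (W.divisionField 5) σu ^ 2))) 5,
      κE.IsCyclotomic → ClassicalMuVanishes κE) :
    MissingUpperBoundAt W 5 :=
  missingUpperBoundAt_tame_of_irreducible_of_fineSelmerDual_fg hKatoA hGZK hmod W 5 hr (by decide) hadd hT hirr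
    (CoatesSujatha2005.fineSelmerDual_moduleFinite_of_zywinaG9Basis_five hCS W e he σu σw σt hσu hσw hσt
      hμP hμA₁ hμA₂ hμA₃ hμB₁ hμD)

end Upper

/-! ### §3 (appended, k8t-c4 g17) The KT door at `p = 5` for SPLIT-Cartan-normaliser image (`5Ns`): U₀ through (A) by
conjA-anchor g11's road R2–R5 (`CoatesSujatha2005.fineSelmerDual_moduleFinite_of_splitCartanBasis_five`, p624652) -/

section UpperSplit

variable (W : WeierstrassCurve ℚ) [W.IsElliptic] [W.IsGloballyMinimal]

/-- **U₀ at a `5Ns` (t′) row from four classical `μ`-hypotheses** (BASIS form, conjA-anchor g11's R5): `ord₅ #Ш(W) ≤ ord₅ #Ш_an(W)`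
(`MissingUpperBoundAt W 5`) for a rank-`0` (t′) row (`Addv W 5`, `SubTprime W 5`) with `W[5]` irreducible, from Kato's fine-Selmer
reading (`hKatoA`), GZK (`hGZK`), modularity (`hmod`), Coates–Sujatha Thm. 3.4 (`hCS`) and Ferrero–Washington (`hFW`) — named facts — a
basis `e` of `W[5]` in which `Γ_ℚ` acts through the split Cartan normaliser `N_s(5)` (`he`), elements `σ_u, σ_v, σ_w` acting as
`diag(2,1)`, `diag(1,2)`, `(0 1; 1 0)` (`hσu hσv hσw`), and `μ = 0` for the cyclotomic `ℤ_5`-extensions of the four fixed fields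
`ℚ(P₁) = ℚ(W[5])^⟨σ̄_v⟩` (8), `ℚ(W[5])^⟨σ̄_u²σ̄_v⟩` (8), `ℚ(x P₁) = ℚ(W[5])^⟨σ̄_u², σ̄_v⟩` (4), `ℚ(⟨P₁+P₂⟩) = ℚ(W[5])^⟨σ̄_uσ̄_v, σ̄_w⟩` (4)
(`hμP hμD hμX hμC`). This is the door for the KT rows 283200dw1, 283200gf1 (the `p = 5` Conj-A residue row: two Tamagawa carriers, so no
unit-twist road — Kato's bound carries the Tamagawa term on the correct side and needs no carrier hypothesis) and 434400l1. CONDITIONAL;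
nothing booked; BSD for no curve. [cite: Kato2004Asterisque, Thm. 14.5 (3) (p. 236), Thm. 12.5 (3) (p. 222)]
[cite: CoatesSujatha2005, Thm. 3.4 (§3)] [cite: Washington1997, §7.5, §13.1] [cite: Serre1972, §2.2] [cite: Lemmermeyer1994, §1] -/
theorem missingUpperBoundAt_five_tame_of_splitCartanBasis_of_mu
    (hKatoA : Kato2004.rankZero_padicValNat_sha_add_padicValNat_tamagawa_le_of_additive_potGood_of_irreducible_of_fineSelmerDual_fg)
    (hGZK : rank_eq_analyticRank_of_analyticRank_le_one) (hmod : hasEntireLFunction_rat)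
    (hCS : CoatesSujatha2005.thm34_fineSelmerDual_moduleFinite_of_classicalMuVanishes_divisionField)
    (hFW : ferreroWashington1979_classicalMuVanishes) [Fact (5 : ℕ).Prime]
    (hr : W.analyticRank = 0) (hadd : Addv W 5) (hT : SubTprime W 5) (hirr : W.HasIrreducibleModPGaloisRep 5)
    (e : W.geomTorsion (5 : ℕ) ≃+ (Fin 2 → ZMod 5))
    (he : ∀ σ : absoluteGaloisGroup ℚ, ∃ M ∈ splitCartanNormalizer 5, ∀ P : W.geomTorsion (5 : ℕ), e (σ • P) = M *ᵥ e P)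
    (σu σv σw : absoluteGaloisGroup ℚ) (hσu : ∀ P : W.geomTorsion (5 : ℕ), e (σu • P) = !![2, 0; 0, 1] *ᵥ e P)
    (hσv : ∀ P : W.geomTorsion (5 : ℕ), e (σv • P) = !![1, 0; 0, 2] *ᵥ e P)
    (hσw : ∀ P : W.geomTorsion (5 : ℕ), e (σw • P) = !![0, 1; 1, 0] *ᵥ e P)
    (hμP : ∀ κE : ZpExtension ↥(fixedField (Subgroup.zpowers (absRestrictNormalHom (W.divisionField 5) σv))) 5,
      κE.IsCyclotomic → ClassicalMuVanishes κE)
    (hμD : ∀ κE : ZpExtension ↥(fixedField (Subgroup.zpowers (absRestrictNormalHom (W.divisionField 5) σu *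
        absRestrictNormalHom (W.divisionField 5) σu * absRestrictNormalHom (W.divisionField 5) σv))) 5,
      κE.IsCyclotomic → ClassicalMuVanishes κE)
    (hμX : ∀ κE : ZpExtension ↥(fixedField (Subgroup.zpowers (absRestrictNormalHom (W.divisionField 5) σu *
        absRestrictNormalHom (W.divisionField 5) σu) ⊔ Subgroup.zpowers (absRestrictNormalHom (W.divisionField 5) σv))) 5,
      κE.IsCyclotomic → ClassicalMuVanishes κE)
    (hμC : ∀ κE : ZpExtension ↥(fixedField (Subgroup.zpowers (absRestrictNormalHom (W.divisionField 5) σu *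
        absRestrictNormalHom (W.divisionField 5) σv) ⊔ Subgroup.zpowers (absRestrictNormalHom (W.divisionField 5) σw))) 5,
      κE.IsCyclotomic → ClassicalMuVanishes κE) :
    MissingUpperBoundAt W 5 :=
  missingUpperBoundAt_tame_of_irreducible_of_fineSelmerDual_fg hKatoA hGZK hmod W 5 hr (by decide) hadd hT hirr
    (CoatesSujatha2005.fineSelmerDual_moduleFinite_of_splitCartanBasis_five hCS hFW W e he σu σv σw hσu hσv hσw
      hμP hμD hμX hμC)

end UpperSplit

/-! ### §4 (appended, k8t-c4 g18) The KT door at `p = 5` for mod-5 image in the INDEX-2 subgroup `G₁₆ = ⟨(0 1; 2 0), diag(1,4)⟩ ≅ M₁₆`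
of `N_s(5)`: U₀ through (A) by the growth-fact-free one-leaf road (`CoatesSujatha2005.fineSelmerDual_moduleFinite_of_splitCartanIndexTwoBasis_five`,
p643448 ∘ `classicalMuVanishes_divisionField_of_splitCartanIndexTwoBasis_five`, p642969) -/

section UpperSplitIndexTwo

variable (W : WeierstrassCurve ℚ) [W.IsElliptic] [W.IsGloballyMinimal]

/-- **U₀ at a (t′) row with mod-5 image in `G₁₆ = ⟨(0 1; 2 0), diag(1,4)⟩ ≅ M₁₆ ⊂ N_s(5)` from ONE classical `μ`-hypothesis** (BASIS form):
`ord₅ #Ш(W) ≤ ord₅ #Ш_an(W)` (`MissingUpperBoundAt W 5`) for a rank-`0` (t′) row (`Addv W 5`, `SubTprime W 5`) with `W[5]` irreducible, from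
Kato's fine-Selmer reading (`hKatoA`), GZK (`hGZK`), modularity (`hmod`), Coates–Sujatha Thm. 3.4 (`hCS`) and Ferrero–Washington (`hFW`) — named
facts — a basis `e` of `W[5]` in which `Γ_ℚ` acts through matrices `M ∈ splitCartanNormalizer 5` of the shapes `c·1`, `c·diag(1,4)`, `c·(0 1; 2 0)`,
`c·(0 1; 3 0)` (`he`: the sixteen elements of `G₁₆`; Cartan part `{diag(a, ±a)}`, commutator subgroup `{±1}`), elements `σ_s, σ_a` acting as
`diag(1,4)`, `(0 1; 2 0)` (`hσs hσa`), and `μ = 0` for the cyclotomic `ℤ_5`-extension of the ONE fixed field `ℚ(P₁) = ℚ(W[5])^⟨σ̄_s⟩` (octic;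
`hμP`) — Kuroda's `V₄ = {±1, ±diag(1,4)}` relation up the tower, the other supports being abelian over `ℚ` (`[G₁₆, G₁₆] = {±1}`) or conjugate to
`ℚ(P₁)`. This is the door for the KT U₀-ns row 446400hu1 @ 5 (image of order `16`, index `2` in `N_s(5)`, `diag(2,1)` NOT in the image, so
outside §3's basis shape; kit j309300 / j311000: `ℚ(P₁) ≅ ℚ[x]/(x⁸ − 120x⁴ − 360x² + 720)`, `h = 2` certified, one prime above `5`). CONDITIONAL;
nothing booked; BSD for no curve. [cite: Kato2004Asterisque, Thm. 14.5 (3) (p. 236), Thm. 12.5 (3) (p. 222)] [cite: CoatesSujatha2005, Thm. 3.4 (§3)]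
[cite: Washington1997, §7.5, §13.1] [cite: Serre1972, §2.2] [cite: Lemmermeyer1994, §1] -/
theorem missingUpperBoundAt_five_tame_of_splitCartanIndexTwoBasis_of_mu
    (hKatoA : Kato2004.rankZero_padicValNat_sha_add_padicValNat_tamagawa_le_of_additive_potGood_of_irreducible_of_fineSelmerDual_fg)
    (hGZK : rank_eq_analyticRank_of_analyticRank_le_one) (hmod : hasEntireLFunction_rat)
    (hCS : CoatesSujatha2005.thm34_fineSelmerDual_moduleFinite_of_classicalMuVanishes_divisionField)
    (hFW : ferreroWashington1979_classicalMuVanishes) [Fact (5 : ℕ).Prime]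
    (hr : W.analyticRank = 0) (hadd : Addv W 5) (hT : SubTprime W 5) (hirr : W.HasIrreducibleModPGaloisRep 5)
    (e : W.geomTorsion (5 : ℕ) ≃+ (Fin 2 → ZMod 5))
    (he : ∀ σ : absoluteGaloisGroup ℚ, ∃ M ∈ splitCartanNormalizer 5, (M 1 1 = M 0 0 ∨ M 1 1 = 4 * M 0 0) ∧
      (M 1 0 = 2 * M 0 1 ∨ M 1 0 = 3 * M 0 1) ∧ ∀ P : W.geomTorsion (5 : ℕ), e (σ • P) = M *ᵥ e P)
    (σs σa : absoluteGaloisGroup ℚ) (hσs : ∀ P : W.geomTorsion (5 : ℕ), e (σs • P) = !![1, 0; 0, 4] *ᵥ e P)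
    (hσa : ∀ P : W.geomTorsion (5 : ℕ), e (σa • P) = !![0, 1; 2, 0] *ᵥ e P)
    (hμP : ∀ κE : ZpExtension ↥(fixedField (Subgroup.zpowers (absRestrictNormalHom (W.divisionField 5) σs))) 5,
      κE.IsCyclotomic → ClassicalMuVanishes κE) :
    MissingUpperBoundAt W 5 :=
  missingUpperBoundAt_tame_of_irreducible_of_fineSelmerDual_fg hKatoA hGZK hmod W 5 hr (by decide) hadd hT hirr
    (CoatesSujatha2005.fineSelmerDual_moduleFinite_of_splitCartanIndexTwoBasis_five hCS hFW W e he σs σa hσs hσa hμP)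

end UpperSplitIndexTwo

/-! ### §5 (appended, k8t-c4 g18) The IMAGE-FREE KT door at any odd `p`: U₀ on an irreducible rank-`0` (t′) row from the Iwasawa-1956
certificate of the WHOLE division field `ℚ(W[p])` (`p ∤ h(ℚ(W[p]))`, one prime above `p`) — Door 1 of
`Literature/…/FineSelmerMuRoadDoors.lean` with its Iwasawa-1956 binder DISCHARGED by the tree theorem
`iwasawa1956_classNumberPExp_eq_zero_of_not_dvd_classNumber_of_unique_prime_holds` (so modulo `hKatoA hGZK hmod hCS` only: no image data,
no Ferrero–Washington) -/

section UpperWholeDivisionField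

variable (W : WeierstrassCurve ℚ) [W.IsElliptic] [W.IsGloballyMinimal]

/-- **U₀ at an irreducible rank-`0` (t′) row from two class-group integers of `ℚ(W[p])`** (image-free door): `ord_p #Ш(W) ≤ ord_p #Ш_an(W)`
(`MissingUpperBoundAt W p`) for a rank-`0` (t′) row (`p` odd, `Addv W p`, `SubTprime W p`) with `W[p]` irreducible, from Kato's fine-Selmer reading
(`hKatoA`), GZK (`hGZK`), modularity (`hmod`) and Coates–Sujatha Thm. 3.4 (`hCS`) — named facts — and the two NUMERIC hypotheses of Iwasawa's
1956 criterion on the whole division field: `p ∤ h(ℚ(W[p]))` (`hh`) and exactly one prime of `ℚ(W[p])` above `p` (`hv`); Iwasawa 1956 itself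
(`e_n = 0` for all `n` up the cyclotomic tower) is the tree THEOREM `iwasawa1956_…_holds`, so no `μ`-hypothesis is displayed. Usable whenever
`h(ℚ(W[p]))` is computable — e.g. the KT U₀-ns row 446400hu1 @ 5, whose division field has degree `16` and root discriminant `≈ 26`
(`|d| = 2^24·3^12·5^14`), a SECOND road for that row beside §4. CONDITIONAL; nothing booked; BSD for no curve.
[cite: Kato2004Asterisque, Thm. 14.5 (3) (p. 236), Thm. 12.5 (3) (p. 222)] [cite: CoatesSujatha2005, Thm. 3.4 (§3)]
[cite: Greenberg2001IwasawaPastPresent, Prop. 2.1 p. 339] [cite: Washington1997, Thm. 10.4, Prop. 13.22] -/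
theorem missingUpperBoundAt_tame_of_not_dvd_classNumber_divisionField_of_unique_prime
    (hKatoA : Kato2004.rankZero_padicValNat_sha_add_padicValNat_tamagawa_le_of_additive_potGood_of_irreducible_of_fineSelmerDual_fg)
    (hGZK : rank_eq_analyticRank_of_analyticRank_le_one) (hmod : hasEntireLFunction_rat)
    (hCS : CoatesSujatha2005.thm34_fineSelmerDual_moduleFinite_of_classicalMuVanishes_divisionField) (p : ℕ) [Fact p.Prime]
    (hr : W.analyticRank = 0) (hp2 : p ≠ 2) (hadd : Addv W p) (hT : SubTprime W p) (hirr : W.HasIrreducibleModPGaloisRep p)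
    (hh : haveI : NeZero p := ⟨(Fact.out : p.Prime).ne_zero⟩
      haveI : NumberField (W.divisionField p) := NumberField.mk
      ¬ p ∣ NumberField.classNumber (W.divisionField p))
    (hv : haveI : NeZero p := ⟨(Fact.out : p.Prime).ne_zero⟩
      haveI : NumberField (W.divisionField p) := NumberField.mk
      ∃! v : IsDedekindDomain.HeightOneSpectrum (NumberField.RingOfIntegers (W.divisionField p)),
        ((p : ℕ) : NumberField.RingOfIntegers (W.divisionField p)) ∈ v.asIdeal) :
    MissingUpperBoundAt W p :=
  missingUpperBoundAt_tame_of_irreducible_of_fineSelmerDual_fg hKatoA hGZK hmod W p hr hp2 hadd hT hirr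
    (CoatesSujatha2005.fineSelmerDual_moduleFinite_of_not_dvd_classNumber_of_unique_prime
      iwasawa1956_classNumberPExp_eq_zero_of_not_dvd_classNumber_of_unique_prime_holds hCS W p hp2 hh hv)

end UpperWholeDivisionField

/-! ### §6 (appended, k8t-c4 g18) The (A)-FORM door, route-free and PUBLIC: U₀ on an irreducible rank-`0` (t′) row from statement (A) at `(W, p)` itself
— §1's private port exported under this namespace (the original `Theorems.missingUpperBoundAt_tame_of_irreducible_of_fineSelmerDual_fg` lives in a
route-importing module), so that a row whose (A)-input is still OPEN (KT: 396900b1 @ 5) can be recorded CONDITIONALLY on (A) with everything else in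
the kernel, and future route-free doors need no further private copy -/

section UpperConjA

variable (W : WeierstrassCurve ℚ) [W.IsElliptic] [W.IsGloballyMinimal]

/-- **U₀ at an irreducible rank-`0` (t′) row from statement (A) at `(W, p)`** (route-free public form of the fine-Selmer port of Kato 14.5 (3)):
`ord_p #Ш(W) ≤ ord_p #Ш_an(W)` (`MissingUpperBoundAt W p`) for `p` odd, `Addv W p`, `SubTprime W p`, `W[p]` irreducible, `r_an = 0`, from the named
facts `hKatoA hGZK hmod` and `hA` = «`Y(W/ℚ_cyc)` is finitely generated over `ℤ_p` for every cyclotomic `ℤ_p`-extension» (Coates–Sujatha's (A) at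
`(W,p)`, displayed). CONDITIONAL; nothing booked; BSD for no curve. [cite: Kato2004Asterisque, Thm. 14.5 (3) (p. 236), Thm. 12.5 (3) (p. 222), 14.14 (p. 243)]
[cite: Lim2017FineSelmer, §3] [cite: Miller2011LMS, Def. 1.1] -/
theorem missingUpperBoundAt_tame_of_conjA
    (hKatoA : Kato2004.rankZero_padicValNat_sha_add_padicValNat_tamagawa_le_of_additive_potGood_of_irreducible_of_fineSelmerDual_fg)
    (hGZK : rank_eq_analyticRank_of_analyticRank_le_one) (hmod : hasEntireLFunction_rat) (p : ℕ) [Fact p.Prime]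
    (hr : W.analyticRank = 0) (hp2 : p ≠ 2) (hadd : Addv W p) (hT : SubTprime W p) (hirr : W.HasIrreducibleModPGaloisRep p)
    (hA : ∀ (κ : ZpExtension ℚ p), κ.IsCyclotomic →
      ∃ (γ : Field.absoluteGaloisGroup ℚ) (D : W.FineSelmerDualData κ γ),
        Module.Finite ℤ_[p] (RestrictScalars ℤ_[p] (IwasawaAlgebra p) D.X)) :
    MissingUpperBoundAt W p :=
  missingUpperBoundAt_tame_of_irreducible_of_fineSelmerDual_fg hKatoA hGZK hmod W p hr hp2 hadd hT hirr hA

end UpperConjA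

end Summit.BirchSwinnertonDyer.BirchSwinnertonDyer.Theorems.CartanMuRoadDoorsTprimeFive

end
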